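import Literature.NumberTheory.DiophantineGeometry.AVIsogenyTateInjectiveClosingProofs
import HarnessLib

/-!
# `rank_ℤ Hom(A, B) ≤ 4 dim A dim B` (Mumford §19, Cor. 1 of Thm. 3): the trust base reduced to
# the Theorem of the Cube and Poincaré reducibility over the algebraic closure

Fourth assembly file for the named fact
`Literature.AlgebraicGeometry.Motives.AbelianVariety.finrank_hom_le` of `AVIsogenyTate`
(`Module.finrank ℤ (A ⟶ B) ≤ 4 * A.dim * B.dim`; Mumford, *Abelian Varieties*, §19, Corollary 1 of
Theorem 3; Milne 1986, Theorem 12.5), after `AVIsogenyTateFinrankHomProofs` (Cor. 1 ⇐ Thm. 3 and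
`T_ℓ ≅ ℤ_ℓ^{2g}`), `AVIsogenyTateFinrankHomAssemblyProofs` (Cor. 1 ⇐ `module_finite_hom` and the
torsion counts) and `AVIsogenyTateFinrankHomCubeProofs` (Cor. 1 ⇐ the Theorem of the Cube, Poincaré
reducibility `hP1`/`hP` and "simple ⇒ isogeny" `hsimple`, all over `K`).

Since then the tree PROVED "a non-zero homomorphism between simple abelian varieties is an isogeny"
over algebraically closed fields (`AbelianVariety.hsimple_of_isAlgClosed`,
`Motives/AbelianVarietyKernelComponent`: images of homomorphisms and identity components of kernels
are abelian subvarieties; Mumford §19, Cor. 2 of Thm. 1) and moved the two geometric inputs of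
Theorem 3 to the algebraic closure (`module_finite_hom_of_theoremOfCube_of_poincare_algebraicClosure`,
`AVIsogenyTateHomKernelProofs`, through `Hom_K(A, B) ↪ Hom_K̄(A_K̄, B_K̄)`). This leaf file records the
consequences for Corollary 1 and for the two companion facts of Theorem 3:

* `AbelianVariety.finrank_hom_le_of_theoremOfCube_of_poincare_algebraicClosure` — **Cor. 1 for all
  `A`, `B` over any field `K` from the Theorem of the Cube (`theoremOfCube_linEquiv`, Görtz–Wedhorn
  II, Thm. 24.73) and Poincaré's complete reducibility theorem (§19 Thm. 1) for abelian varieties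
  over `K̄` only**; `module_free_hom_…` likewise (the Tate-map form
  `faltingsTateMap_injective_of_theoremOfCube_of_poincare_algebraicClosure` is in
  `AVIsogenyTateInjectiveClosingProofs`, imported);
* `…_of_pseudoCoherent_general_of_poincare_algebraicClosure` — the same with the cube replaced by its
  trust base in the tree, the named fact `cechComplex_pseudoCoherent_general` (Görtz–Wedhorn II,
  Thm. 23.133 / Cor. 23.135; `theoremOfCube_linEquiv_of_pseudoCoherent_general`);
* `…_of_finite_cohomology_of_poincare_algebraicClosure` (`module_finite_hom`, `module_free_hom`,
  `faltingsTateMap_injective`, `finrank_hom_le`) — the same with the cube replaced by the finest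
  input the tree offers: finite generation of the cohomology of the ordered Čech complexes
  `Č•(𝔚, 𝒪(D))` over affine integral bases of finite type (the finiteness theorem for proper
  morphisms, Görtz–Wedhorn II, Thm. 23.17; EGA III 3.2.1), through
  `theoremOfCube_linEquiv_of_finite_cohomology` (`Motives/AbelianVarietyTheoremOfCubeProofs`, with
  Step (IV) of the proof of Thm. 23.133 proved in `Motives/CechComplexPseudoCoherentDescent`);
* `…_of_theoremOfCube_of_isogeny_biprod_algebraicClosure`,
  `finrank_hom_le_of_pseudoCoherent_general_of_isogeny_biprod_algebraicClosure` — the variants with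
  Poincaré reducibility in the two-sided splitting form `hP` over `K̄` (§19 Thm. 1 with Cor. 1: a
  non-simple `X` admits isogenies `X₁ ⊞ X₂ → X → X₁ ⊞ X₂` with `dim Xᵢ < dim X`), through
  `module_finite_hom_of_theoremOfCube_of_isogeny_biprod_algebraicClosure`
  (`AVIsogenyTateInjectiveClosingProofs`).

So in the tree `finrank_hom_le` now rests on exactly: the finiteness of coherent cohomology for
proper morphisms (in the Čech form above) and Poincaré's complete reducibility theorem over
algebraically closed fields (§19 Thm. 1; its finiteness half `Y ∩ Y^⊥` finite is
`Motives/AbelianVarietyTranslationInvariantAmple`, the complement `Y + Y^⊥ = X` needs `dim Ŷ = dim Y`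
or §8 Thm. 1 and is not in the tree). The discharge `finrank_hom_le_holds` is
`finrank_hom_le_of_theoremOfCube_of_poincare_algebraicClosure theoremOfCube_linEquiv_holds hP1_K̄ A B`
once both land; it is **not** asserted here.

## References

* [MumfordAV1970] D. Mumford, *Abelian Varieties*, TIFR Studies in Mathematics 5, OUP (1970):
  §19, Thm. 3 with its proof and Cor. 1 (pp. 176–178 of the 2nd ed.), Thm. 1 with Cor. 1–2
  (pp. 173–174). Not held; architecture as in Milne 1986, §12.
* [Milne1986AbelianVarieties] J. S. Milne, *Abelian Varieties*, in: Cornell–Silverman (eds.),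
  *Arithmetic Geometry*, Springer 1986, Thm. 12.5 (stated over an arbitrary field), Lemmas
  12.6–12.7, Prop. 12.1 (held: `book:cornellnd-arithmetic-geometry`, PDF pp. 190–192).
* [GortzWedhorn2023] U. Görtz, T. Wedhorn, *Algebraic Geometry II*, Springer 2023: Thm. 24.73
  (p. 550), Thm. 23.133 / Cor. 23.135 (pp. 478–480), Thm. 23.17 (p. 444).

## Design

No definitions, no named facts (D-0026): every declaration is a theorem; `hP1`, `hP` are spelled
verbatim as in `AVIsogenyTateHomKernelProofs` / `AVIsogenyTateInjectiveClosingProofs`, the finiteness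
hypothesis verbatim as in `theoremOfCube_linEquiv_of_finite_cohomology`. A leaf file (nothing imports
it): `AVIsogenyTateInjectiveClosingProofs` imports `AVIsogenyTateHomKernelProofs`, which imports
`AVIsogenyTateHomCubeProofs`, which imports `AVIsogenyTateFinrankHomCubeProofs`, so these corollaries
cannot be appended there.
-/

universe u

open CategoryTheory CategoryTheory.Limits AlgebraicGeometry MonoidalCategory

noncomputable section

namespace Literature.NumberTheory.DiophantineGeometry

section AbelianVariety
open Literature.AlgebraicGeometry.Motives (AbelianVariety SchemeOver CartierDivisor theoremOfCube_linEquiv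
  cechComplex_pseudoCoherent_general theoremOfCube_linEquiv_of_pseudoCoherent_general
  theoremOfCube_linEquiv_of_finite_cohomology)
open Literature.AlgebraicGeometry.Motives.AbelianVariety

variable {K : Type u} [Field K]

/-! ### From the Theorem of the Cube and Poincaré reducibility over `K̄` -/

/-- **Mumford §19, Theorem 3 with Corollary 1 (`Hom(A, B)` is free) from the Theorem of the Cube and
Poincaré reducibility over `K̄`**: finitely generated
(`module_finite_hom_of_theoremOfCube_of_poincare_algebraicClosure`) and torsion-free because `[n]_A`
is an isogeny (`isIsogeny_zsmul_id_of_theoremOfCube_linEquiv`), hence free over the PID `ℤ`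
(`module_free_hom_of_module_finite_hom_of_isIsogeny_zsmul_id`). [cite: MumfordAV1970, §19 Thm. 3 and Cor. 1] -/
theorem _root_.Literature.AlgebraicGeometry.Motives.AbelianVariety.module_free_hom_of_theoremOfCube_of_poincare_algebraicClosure
    (hcube : theoremOfCube_linEquiv.{u})
    (hP1 : ∀ (X Y : AbelianVariety (AlgebraicClosure K)) (i : Y ⟶ X),
      IsClosedImmersion (Hom.toSchemeHom i) → 0 < Y.dim → Y.dim < X.dim →
      ∃ (Z : AbelianVariety (AlgebraicClosure K)) (j : Z ⟶ X),
        IsClosedImmersion (Hom.toSchemeHom j) ∧ IsIsogeny (biprod.desc i j))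
    (A B : AbelianVariety K) : module_free_hom A B :=
  module_free_hom_of_module_finite_hom_of_isIsogeny_zsmul_id
    (module_finite_hom_of_theoremOfCube_of_poincare_algebraicClosure hcube hP1 A B)
    (A.isIsogeny_zsmul_id_of_theoremOfCube_linEquiv hcube)

/-- **Mumford §19, Corollary 1 of Theorem 3 (`rank_ℤ Hom(A, B) ≤ 4 dim A dim B`) for all `A`, `B`
over any field `K`, from the Theorem of the Cube and Poincaré's complete reducibility theorem over
the algebraic closure `K̄`.** Theorem 3 is
`module_finite_hom_of_theoremOfCube_of_poincare_algebraicClosure` ("simple ⇒ isogeny", §19 Cor. 2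
of Thm. 1, being the theorem `hsimple_of_isAlgClosed` over `K̄`), the torsion counts
`#A[n](K̄) = n^{2 dim A}`, `#B[n](K̄) = n^{2 dim B}` (whence `T_ℓ ≅ ℤ_ℓ^{2 dim}`) are
`natCard_torsionPoints_of_isAlgClosed_of_theoremOfCube_linEquiv`, and Corollary 1 is then
`finrank_hom_le_of_module_finite_hom` ("clearly it suffices to prove the second statement",
Milne 1986, proof of Thm. 12.5). Granted `theoremOfCube_linEquiv_holds` and a proof of `hP1` over
algebraically closed fields, `finrank_hom_le_holds` is this theorem applied to them.
[cite: MumfordAV1970, §19 Cor. 1 of Thm. 3] [cite: Milne1986AbelianVarieties, Thm. 12.5 (PDF p. 190)] -/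
theorem _root_.Literature.AlgebraicGeometry.Motives.AbelianVariety.finrank_hom_le_of_theoremOfCube_of_poincare_algebraicClosure
    (hcube : theoremOfCube_linEquiv.{u})
    (hP1 : ∀ (X Y : AbelianVariety (AlgebraicClosure K)) (i : Y ⟶ X),
      IsClosedImmersion (Hom.toSchemeHom i) → 0 < Y.dim → Y.dim < X.dim →
      ∃ (Z : AbelianVariety (AlgebraicClosure K)) (j : Z ⟶ X),
        IsClosedImmersion (Hom.toSchemeHom j) ∧ IsIsogeny (biprod.desc i j))
    (A B : AbelianVariety K) : finrank_hom_le A B :=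
  finrank_hom_le_of_module_finite_hom A B
    (module_finite_hom_of_theoremOfCube_of_poincare_algebraicClosure hcube hP1 A B)
    (A.natCard_torsionPoints_of_isAlgClosed_of_theoremOfCube_linEquiv (AlgebraicClosure K) hcube)
    (B.natCard_torsionPoints_of_isAlgClosed_of_theoremOfCube_linEquiv (AlgebraicClosure K) hcube)

/-! ### One named fact left on the cube side: the pseudo-coherence of the Čech complex of `𝒪(D)` -/

/-- **Mumford §19, Theorem 3 (`Hom(A, B)` finitely generated) from the finiteness theorem for proper
morphisms (`cechComplex_pseudoCoherent_general`, Görtz–Wedhorn II, Thm. 23.133 / Cor. 23.135) and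
Poincaré reducibility over `K̄`.** [cite: MumfordAV1970, §19 Thm. 3]
[cite: GortzWedhorn2023, Thm. 24.73 (p. 550) with Thm. 23.133 / Cor. 23.135 (pp. 478–480)] -/
theorem _root_.Literature.AlgebraicGeometry.Motives.AbelianVariety.module_finite_hom_of_pseudoCoherent_general_of_poincare_algebraicClosure
    (h : cechComplex_pseudoCoherent_general.{u})
    (hP1 : ∀ (X Y : AbelianVariety (AlgebraicClosure K)) (i : Y ⟶ X),
      IsClosedImmersion (Hom.toSchemeHom i) → 0 < Y.dim → Y.dim < X.dim →
      ∃ (Z : AbelianVariety (AlgebraicClosure K)) (j : Z ⟶ X),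
        IsClosedImmersion (Hom.toSchemeHom j) ∧ IsIsogeny (biprod.desc i j))
    (A B : AbelianVariety K) : module_finite_hom A B :=
  module_finite_hom_of_theoremOfCube_of_poincare_algebraicClosure
    (theoremOfCube_linEquiv_of_pseudoCoherent_general h) hP1 A B

/-- **`Hom(A, B)` free (§19 Thm. 3 with Cor. 1) from `cechComplex_pseudoCoherent_general` and
Poincaré reducibility over `K̄`.** [cite: MumfordAV1970, §19 Thm. 3 and Cor. 1] -/
theorem _root_.Literature.AlgebraicGeometry.Motives.AbelianVariety.module_free_hom_of_pseudoCoherent_general_of_poincare_algebraicClosure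
    (h : cechComplex_pseudoCoherent_general.{u})
    (hP1 : ∀ (X Y : AbelianVariety (AlgebraicClosure K)) (i : Y ⟶ X),
      IsClosedImmersion (Hom.toSchemeHom i) → 0 < Y.dim → Y.dim < X.dim →
      ∃ (Z : AbelianVariety (AlgebraicClosure K)) (j : Z ⟶ X),
        IsClosedImmersion (Hom.toSchemeHom j) ∧ IsIsogeny (biprod.desc i j))
    (A B : AbelianVariety K) : module_free_hom A B :=
  module_free_hom_of_theoremOfCube_of_poincare_algebraicClosure
    (theoremOfCube_linEquiv_of_pseudoCoherent_general h) hP1 A B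

/-- **Mumford §19, Corollary 1 of Theorem 3 (`rank_ℤ Hom(A, B) ≤ 4 dim A dim B`) from the finiteness
theorem for proper morphisms (`cechComplex_pseudoCoherent_general`) and Poincaré's complete
reducibility theorem over `K̄`** — the current trust base of the named fact `finrank_hom_le` in this
tree. [cite: MumfordAV1970, §19 Cor. 1 of Thm. 3]
[cite: GortzWedhorn2023, Thm. 24.73 (p. 550) with Thm. 23.133 / Cor. 23.135 (pp. 478–480)] -/
theorem _root_.Literature.AlgebraicGeometry.Motives.AbelianVariety.finrank_hom_le_of_pseudoCoherent_general_of_poincare_algebraicClosure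
    (h : cechComplex_pseudoCoherent_general.{u})
    (hP1 : ∀ (X Y : AbelianVariety (AlgebraicClosure K)) (i : Y ⟶ X),
      IsClosedImmersion (Hom.toSchemeHom i) → 0 < Y.dim → Y.dim < X.dim →
      ∃ (Z : AbelianVariety (AlgebraicClosure K)) (j : Z ⟶ X),
        IsClosedImmersion (Hom.toSchemeHom j) ∧ IsIsogeny (biprod.desc i j))
    (A B : AbelianVariety K) : finrank_hom_le A B :=
  finrank_hom_le_of_theoremOfCube_of_poincare_algebraicClosure
    (theoremOfCube_linEquiv_of_pseudoCoherent_general h) hP1 A B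

/-! ### The finest cube-side input: finiteness of Čech cohomology over bases of finite type -/

/-- **Mumford §19, Theorem 3 (`Hom(A, B)` finitely generated) from the finiteness of the cohomology of
the ordered Čech complexes `Č•(𝔚, 𝒪(D))` over affine integral bases of finite type (the finiteness
theorem for proper morphisms, Görtz–Wedhorn II, Thm. 23.17 / Prop. 23.23; EGA III 3.2.1) and Poincaré
reducibility over `K̄`** — the cube being `theoremOfCube_linEquiv_of_finite_cohomology`.
[cite: MumfordAV1970, §19 Thm. 3]
[cite: GortzWedhorn2023, Thm. 24.73, proof (p. 550), with Thm. 23.133, proof (pp. 478–479) and Thm. 23.17 (p. 444)] -/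
theorem _root_.Literature.AlgebraicGeometry.Motives.AbelianVariety.module_finite_hom_of_finite_cohomology_of_poincare_algebraicClosure
    (h : ∀ (K : Type u) [Field K] (X T : SchemeOver K) [IsProper X.hom] [IsAffine T.left]
      [IsIntegral T.left] [LocallyOfFiniteType T.hom] [IsNoetherianRing Γ(T.left, ⊤)]
      [IsIntegral (X ⊗ T).left] (D : CartierDivisor (X ⊗ T).left)
      (𝔚 : CartierDivisor.CechCover (CartesianMonoidalCategory.snd X T).left ⊤ D) (n : ℤ),
      Module.Finite Γ(T.left, ⊤) (𝔚.complex.homology n))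
    (hP1 : ∀ (X Y : AbelianVariety (AlgebraicClosure K)) (i : Y ⟶ X),
      IsClosedImmersion (Hom.toSchemeHom i) → 0 < Y.dim → Y.dim < X.dim →
      ∃ (Z : AbelianVariety (AlgebraicClosure K)) (j : Z ⟶ X),
        IsClosedImmersion (Hom.toSchemeHom j) ∧ IsIsogeny (biprod.desc i j))
    (A B : AbelianVariety K) : module_finite_hom A B :=
  module_finite_hom_of_theoremOfCube_of_poincare_algebraicClosure
    (theoremOfCube_linEquiv_of_finite_cohomology h) hP1 A B

/-- **`Hom(A, B)` free (§19 Thm. 3 with Cor. 1) from the finiteness of Čech cohomology over bases of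
finite type and Poincaré reducibility over `K̄`.** [cite: MumfordAV1970, §19 Thm. 3 and Cor. 1] -/
theorem _root_.Literature.AlgebraicGeometry.Motives.AbelianVariety.module_free_hom_of_finite_cohomology_of_poincare_algebraicClosure
    (h : ∀ (K : Type u) [Field K] (X T : SchemeOver K) [IsProper X.hom] [IsAffine T.left]
      [IsIntegral T.left] [LocallyOfFiniteType T.hom] [IsNoetherianRing Γ(T.left, ⊤)]
      [IsIntegral (X ⊗ T).left] (D : CartierDivisor (X ⊗ T).left)
      (𝔚 : CartierDivisor.CechCover (CartesianMonoidalCategory.snd X T).left ⊤ D) (n : ℤ),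
      Module.Finite Γ(T.left, ⊤) (𝔚.complex.homology n))
    (hP1 : ∀ (X Y : AbelianVariety (AlgebraicClosure K)) (i : Y ⟶ X),
      IsClosedImmersion (Hom.toSchemeHom i) → 0 < Y.dim → Y.dim < X.dim →
      ∃ (Z : AbelianVariety (AlgebraicClosure K)) (j : Z ⟶ X),
        IsClosedImmersion (Hom.toSchemeHom j) ∧ IsIsogeny (biprod.desc i j))
    (A B : AbelianVariety K) : module_free_hom A B :=
  module_free_hom_of_theoremOfCube_of_poincare_algebraicClosure
    (theoremOfCube_linEquiv_of_finite_cohomology h) hP1 A B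

/-- **Injectivity of `ℤ_ℓ ⊗ Hom(A, B) → Hom_{Γ_K}(T_ℓ A, T_ℓ B)` (§19 Thm. 3) from the finiteness of
Čech cohomology over bases of finite type and Poincaré reducibility over `K̄`.**
[cite: MumfordAV1970, §19 Thm. 3] [cite: Milne1986AbelianVarieties, Thm. 12.5 (PDF pp. 190–192)] -/
theorem _root_.Literature.AlgebraicGeometry.Motives.AbelianVariety.faltingsTateMap_injective_of_finite_cohomology_of_poincare_algebraicClosure
    (h : ∀ (K : Type u) [Field K] (X T : SchemeOver K) [IsProper X.hom] [IsAffine T.left]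
      [IsIntegral T.left] [LocallyOfFiniteType T.hom] [IsNoetherianRing Γ(T.left, ⊤)]
      [IsIntegral (X ⊗ T).left] (D : CartierDivisor (X ⊗ T).left)
      (𝔚 : CartierDivisor.CechCover (CartesianMonoidalCategory.snd X T).left ⊤ D) (n : ℤ),
      Module.Finite Γ(T.left, ⊤) (𝔚.complex.homology n))
    (hP1 : ∀ (X Y : AbelianVariety (AlgebraicClosure K)) (i : Y ⟶ X),
      IsClosedImmersion (Hom.toSchemeHom i) → 0 < Y.dim → Y.dim < X.dim →
      ∃ (Z : AbelianVariety (AlgebraicClosure K)) (j : Z ⟶ X),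
        IsClosedImmersion (Hom.toSchemeHom j) ∧ IsIsogeny (biprod.desc i j))
    (A B : AbelianVariety K) : faltingsTateMap_injective A B :=
  faltingsTateMap_injective_of_theoremOfCube_of_poincare_algebraicClosure
    (theoremOfCube_linEquiv_of_finite_cohomology h) hP1 A B

/-- **Mumford §19, Corollary 1 of Theorem 3 (`rank_ℤ Hom(A, B) ≤ 4 dim A dim B`) from the finiteness
of the cohomology of the ordered Čech complexes `Č•(𝔚, 𝒪(D))` over affine integral bases of finite
type and Poincaré's complete reducibility theorem over `K̄`** — the finest trust base the tree offers
for the named fact `finrank_hom_le`: the hypothesis `h` is all that separates the Theorem of the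
Cube from a theorem of this tree (`theoremOfCube_linEquiv_of_finite_cohomology`), and `hP1` is §19
Thm. 1 over algebraically closed fields. [cite: MumfordAV1970, §19 Cor. 1 of Thm. 3]
[cite: GortzWedhorn2023, Thm. 24.73, proof (p. 550), with Thm. 23.133, proof (pp. 478–479) and Thm. 23.17 (p. 444)] -/
theorem _root_.Literature.AlgebraicGeometry.Motives.AbelianVariety.finrank_hom_le_of_finite_cohomology_of_poincare_algebraicClosure
    (h : ∀ (K : Type u) [Field K] (X T : SchemeOver K) [IsProper X.hom] [IsAffine T.left]
      [IsIntegral T.left] [LocallyOfFiniteType T.hom] [IsNoetherianRing Γ(T.left, ⊤)]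
      [IsIntegral (X ⊗ T).left] (D : CartierDivisor (X ⊗ T).left)
      (𝔚 : CartierDivisor.CechCover (CartesianMonoidalCategory.snd X T).left ⊤ D) (n : ℤ),
      Module.Finite Γ(T.left, ⊤) (𝔚.complex.homology n))
    (hP1 : ∀ (X Y : AbelianVariety (AlgebraicClosure K)) (i : Y ⟶ X),
      IsClosedImmersion (Hom.toSchemeHom i) → 0 < Y.dim → Y.dim < X.dim →
      ∃ (Z : AbelianVariety (AlgebraicClosure K)) (j : Z ⟶ X),
        IsClosedImmersion (Hom.toSchemeHom j) ∧ IsIsogeny (biprod.desc i j))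
    (A B : AbelianVariety K) : finrank_hom_le A B :=
  finrank_hom_le_of_theoremOfCube_of_poincare_algebraicClosure
    (theoremOfCube_linEquiv_of_finite_cohomology h) hP1 A B

/-! ### From the Theorem of the Cube and the two-sided splitting form `hP` over `K̄` -/

/-- **`Hom(A, B)` free (§19 Thm. 3 with Cor. 1) from the Theorem of the Cube and Poincaré
reducibility in two-sided splitting form over `K̄`** (every non-simple `X` over `K̄` admits isogenies
`X₁ ⊞ X₂ → X → X₁ ⊞ X₂` with `dim Xᵢ < dim X`; §19 Thm. 1 with Cor. 1):
`module_finite_hom_of_theoremOfCube_of_isogeny_biprod_algebraicClosure`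
(`AVIsogenyTateInjectiveClosingProofs`) and torsion-freeness from `[n]_A` an isogeny.
[cite: MumfordAV1970, §19 Thm. 3 and Cor. 1] -/
theorem _root_.Literature.AlgebraicGeometry.Motives.AbelianVariety.module_free_hom_of_theoremOfCube_of_isogeny_biprod_algebraicClosure
    (hcube : theoremOfCube_linEquiv.{u})
    (hP : ∀ X : AbelianVariety (AlgebraicClosure K), ¬ IsSimple X →
      ∃ X₁ X₂ : AbelianVariety (AlgebraicClosure K),
        X₁.dim < X.dim ∧ X₂.dim < X.dim ∧ (∃ σ : X₁ ⊞ X₂ ⟶ X, IsIsogeny σ) ∧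
          ∃ τ : X ⟶ X₁ ⊞ X₂, IsIsogeny τ)
    (A B : AbelianVariety K) : module_free_hom A B :=
  module_free_hom_of_module_finite_hom_of_isIsogeny_zsmul_id
    (module_finite_hom_of_theoremOfCube_of_isogeny_biprod_algebraicClosure hcube hP A B)
    (A.isIsogeny_zsmul_id_of_theoremOfCube_linEquiv hcube)

/-- **Mumford §19, Corollary 1 of Theorem 3 (`rank_ℤ Hom(A, B) ≤ 4 dim A dim B`) for all `A`, `B`
over any field `K`, from the Theorem of the Cube and Poincaré reducibility in two-sided splitting
form over `K̄`**: Theorem 3 is `module_finite_hom_of_theoremOfCube_of_isogeny_biprod_algebraicClosure`,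
the torsion counts are `natCard_torsionPoints_of_isAlgClosed_of_theoremOfCube_linEquiv`, and
Corollary 1 is `finrank_hom_le_of_module_finite_hom`.
[cite: MumfordAV1970, §19 Cor. 1 of Thm. 3] [cite: Milne1986AbelianVarieties, Thm. 12.5 (PDF p. 190)] -/
theorem _root_.Literature.AlgebraicGeometry.Motives.AbelianVariety.finrank_hom_le_of_theoremOfCube_of_isogeny_biprod_algebraicClosure
    (hcube : theoremOfCube_linEquiv.{u})
    (hP : ∀ X : AbelianVariety (AlgebraicClosure K), ¬ IsSimple X →
      ∃ X₁ X₂ : AbelianVariety (AlgebraicClosure K),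
        X₁.dim < X.dim ∧ X₂.dim < X.dim ∧ (∃ σ : X₁ ⊞ X₂ ⟶ X, IsIsogeny σ) ∧
          ∃ τ : X ⟶ X₁ ⊞ X₂, IsIsogeny τ)
    (A B : AbelianVariety K) : finrank_hom_le A B :=
  finrank_hom_le_of_module_finite_hom A B
    (module_finite_hom_of_theoremOfCube_of_isogeny_biprod_algebraicClosure hcube hP A B)
    (A.natCard_torsionPoints_of_isAlgClosed_of_theoremOfCube_linEquiv (AlgebraicClosure K) hcube)
    (B.natCard_torsionPoints_of_isAlgClosed_of_theoremOfCube_linEquiv (AlgebraicClosure K) hcube)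

/-- **Mumford §19, Corollary 1 of Theorem 3 from `cechComplex_pseudoCoherent_general` and Poincaré
reducibility in two-sided splitting form over `K̄`.** [cite: MumfordAV1970, §19 Cor. 1 of Thm. 3]
[cite: GortzWedhorn2023, Thm. 24.73 (p. 550) with Thm. 23.133 / Cor. 23.135 (pp. 478–480)] -/
theorem _root_.Literature.AlgebraicGeometry.Motives.AbelianVariety.finrank_hom_le_of_pseudoCoherent_general_of_isogeny_biprod_algebraicClosure
    (h : cechComplex_pseudoCoherent_general.{u})
    (hP : ∀ X : AbelianVariety (AlgebraicClosure K), ¬ IsSimple X →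
      ∃ X₁ X₂ : AbelianVariety (AlgebraicClosure K),
        X₁.dim < X.dim ∧ X₂.dim < X.dim ∧ (∃ σ : X₁ ⊞ X₂ ⟶ X, IsIsogeny σ) ∧
          ∃ τ : X ⟶ X₁ ⊞ X₂, IsIsogeny τ)
    (A B : AbelianVariety K) : finrank_hom_le A B :=
  finrank_hom_le_of_theoremOfCube_of_isogeny_biprod_algebraicClosure
    (theoremOfCube_linEquiv_of_pseudoCoherent_general h) hP A B

end AbelianVariety

end Literature.NumberTheory.DiophantineGeometry

end
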